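import Literature.NumberTheory.IwasawaTheory.Greenberg2016.ShaOneDualTorsionOfShaDuality
import Literature.NumberTheory.IwasawaTheory.Greenberg2016.ShaOneDualLevels
import Literature.NumberTheory.IwasawaTheory.Greenberg2016.DualSelmerTorsionGlue
import HarnessLib

/-!
# Greenberg 2010 Prop. 3.2.1 (γ) for the `𝐃[𝔪ᵏ]`-tower: `Ш¹(K, Σ, T*)` is `Λ`-torsion under `LEO`,
# from a tower of restricted Ш-dualities on the concrete level sets (theorems only)

Topic `NumberTheory/IwasawaTheory/Greenberg2016`; namespace
`Literature.NumberTheory.IwasawaTheory.Greenberg2016`; THEOREMS ONLY (no definition, no named fact, no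
`sorry`, no instance).  Lane «SUR-Λ» of cell `bsd-eis` (road memo `SUR-LAMBDA-ROAD-w5g9.md` §2 ★(γ),
brick C7b part 5 = the instantiation of `exists_nonZeroDivisor_dualEndHom_eq_zero_of_LEO` at
Greenberg's tower `E := torsionLayers ρ e hD` (`D_k = 𝐃[𝔪ᵏ]`), `Sh1 := shaOneDualLevel S E`, and the
tree's `dualSha` / `scalarDualEndHom`), `--supports stmt-BirchSwinnertonDyer-19032`.

* `torsionBySet_maximalIdeal_pow_mono` — the `Λ`-submodules `𝐃[𝔪ᵏ] = Submodule.torsionBySet Λ 𝐃 ↑(𝔪ᵏ)`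
  are increasing (their `Gal(K_Σ/K)`-stability and unramifiedness off `S` are the tree's
  `torsionBySet_maximalIdeal_pow_le_comap` / `isUnramifiedAt_layerRep_torsionLayers`);
* **`dualSha_torsion_of_shaDualityTower`** — GIVEN a tower of restricted Ш-dualities
  `b k : Ш²(K, Σ, 𝐃[𝔪ᵏ]) × Ш¹ᴰ_k → ℚ/ℤ` (`IsShaDualityTower`, right non-degeneracy `hDa`, `Λ`-balance
  `hDb₂`) and `LEO S ρ`: every `y ∈ dualSha ρ e hD inv` (for any family `inv` of local invariants obeying
  its level law and «unramified ⟂ unramified», as hypotheses `hinv` / `hUO` exactly as in the tree's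
  `exists_ne_zero_scalar_mem_dualSha_of_mem_dualSelmer`) is killed by `H¹(θ̂_r)` for some `r ≠ 0`:
  **the hypothesis `hSha` of `Specification.sur_of_dualSelmer_inputs`**, modulo the tower.

HONESTY: no duality, no case of Greenberg's propositions and nothing about BSD is proved here; the
tower (`b`, `hT`, `hDa`, `hDb₂`) is the input the restricted Poitou–Tate Ш-duality (Milne ADT I 4.10 (a),
natural form) supplies through `ShaRestrictedBridges`.  AI formalisation, weaker than expert review;
the statements are established only by the kernel check.

## References
* R. Greenberg, *Surjectivity of the global-to-local map defining a Selmer group*, Kyoto J. Math.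
  50 (2010) 853–888, §2.1 (6)–(7) p. 7, proof of Prop. 3.2.1 p. 15. [Greenberg2010]
* J. S. Milne, *Arithmetic Duality Theorems*, 2nd ed. (2006), I Thm. 4.10 (a). [MilneADT2006]
-/

noncomputable section

open scoped Classical
open Function CategoryTheory NumberField IsDedekindDomain Field IsLocalRing
open _root_.TopRep _root_.ContRepresentation _root_.ContinuousCohomology
open Literature.NumberTheory.GaloisRepresentations
open Literature.NumberTheory.GaloisRepresentations.DiscreteGaloisModule
open Literature.NumberTheory.GaloisRepresentations.DiscreteGaloisModule.TorsionLayers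
open Literature.NumberTheory.GaloisCohomology
open Literature.NumberTheory.IwasawaTheory.Greenberg2006

namespace Literature.NumberTheory.IwasawaTheory.Greenberg2016

variable {K : Type} [Field K] [NumberField K] {S : Set (HeightOneSpectrum (𝓞 K))}
  {Λ : Type} [CommRing Λ] [TopologicalSpace Λ]
  {D : Type} [AddCommGroup D] [Module Λ D] [TopologicalSpace D] [DiscreteTopology D]
  [ContinuousSMul Λ D]
  (ρ : ContinuousRep (GaloisGroupUnramifiedOutside K S) Λ D)

/-! ### The `Λ`-submodules `𝐃[𝔪ᵏ]` -/

omit [TopologicalSpace Λ] [TopologicalSpace D] [DiscreteTopology D] [ContinuousSMul Λ D] in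
/-- `k ↦ 𝐃[𝔪ᵏ]` is increasing. [cite: Greenberg2010, §2 p. 6 L1–12] -/
theorem torsionBySet_maximalIdeal_pow_mono [IsLocalRing Λ] :
    Monotone fun k : ℕ => Submodule.torsionBySet Λ D ((maximalIdeal Λ ^ k : Ideal Λ) : Set Λ) :=
  fun k l hkl d hd => by
    rw [Submodule.mem_torsionBySet_iff] at hd ⊢
    rintro ⟨r, hr⟩
    exact hd ⟨r, Ideal.pow_le_pow_right hkl hr⟩

variable {p : ℕ} [Fact p.Prime] {m : ℕ} [IsLocalRing Λ]
  (e : Λ ≃+* MvPowerSeries (Fin m) ℤ_[p]) (hD : IsCofinitelyGenerated Λ D)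

/-! ### (γ) for the `𝐃[𝔪ᵏ]`-tower -/

/-- **`Ш¹(K, Σ, T*)` is `Λ`-torsion under `LEO(𝐃)`, granted the tower of restricted Ш-dualities on
the levels `(Ш²(K, Σ, 𝐃[𝔪ᵏ]), Ш¹ᴰ_k)`** — the hypothesis `hSha` of the tree's
`Specification.sur_of_dualSelmer_inputs`: for `y ∈ dualSha ρ e hD inv`, some `r ≠ 0` has
`H¹(θ̂_r) y = 0`.  Proof: the level components `y_k` lie in `Ш¹ᴰ_k` (`projHom_mem_shaOneDualLevel`),
`Ш¹ᴰ_•` is stable under the `θ̂_{r,k}` (`layerDualEndHom_mem_shaOneDualLevel`), so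
`exists_nonZeroDivisor_dualEndHom_eq_zero_of_LEO` applies; a non-zero-divisor of the local ring `Λ` is
`≠ 0`. [cite: Greenberg2010, proof of Prop. 3.2.1 (p. 15 L19–21), §2.1 (6) p. 7]
[cite: MilneADT2006, Ch. I, Thm. 4.10(a)] -/
theorem dualSha_torsion_of_shaDualityTower [Finite (SigmaPlace S)] [CompactSpace (absoluteGaloisGroup K)]
    (inv : ∀ k : ℕ, LocalInvariants K (p ^ k))
    (hinv : ∀ v : Place K, InvLevelLaw inv v) (hUO : ∀ k, (inv k).UnramifiedOrthogonal)
    (hSp : ∀ w : HeightOneSpectrum (𝓞 K), ((p : ℕ) : 𝓞 K) ∈ w.asIdeal → w ∈ S)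
    (b : ∀ k, ↥(sha2 S (ρ.subrepresentation
        (Submodule.torsionBySet Λ D ((maximalIdeal Λ ^ k : Ideal Λ) : Set Λ)) (torsionBySet_maximalIdeal_pow_le_comap ρ k))) →+
      ↥(shaOneDualLevel S (torsionLayers ρ e hD) k) →+ AddCircle (1 : ℚ))
    (hT : IsShaDualityTower (E := torsionLayers ρ e hD) (hN := torsionBySet_maximalIdeal_pow_le_comap ρ)
      torsionBySet_maximalIdeal_pow_mono (shaOneDualLevel S (torsionLayers ρ e hD)) b)
    (hDa : ∀ k (z : ↥(shaOneDualLevel S (torsionLayers ρ e hD) k)), (∀ x, b k x z = 0) → z = 0)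
    (hDb₂ : ∀ (r : Λ) k
      (x : ↥(sha2 S (ρ.subrepresentation
        (Submodule.torsionBySet Λ D ((maximalIdeal Λ ^ k : Ideal Λ) : Set Λ)) (torsionBySet_maximalIdeal_pow_le_comap ρ k))))
      (z : ↥(shaOneDualLevel S (torsionLayers ρ e hD) k)),
      b k ⟨r • x.1, Submodule.smul_mem _ r x.2⟩ z =
        b k x ⟨_, layerDualEndHom_mem_shaOneDualLevel S (torsionLayers ρ e hD) (DistribSMul.toAddMonoidHom D r)
          (fun k d hd => smul_mem_torsionLayers ρ e hD k r d hd) (smul_toGaloisModule_apply r) k z.2⟩)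
    (hLEO : LEO S ρ)
    (y : continuousCohomology 1 (torsionLayers ρ e hD).dualSystem.limitRep.toTopRep)
    (hy : y ∈ dualSha ρ e hD inv) :
    ∃ r : Λ, r ≠ 0 ∧ cohomologyMap (scalarDualEndHom ρ e hD r) 1 y = 0 := by
  haveI : NeZero p := ⟨(Fact.out : p.Prime).ne_zero⟩
  haveI : ∀ k, Finite ((torsionLayers ρ e hD).N k) := fun k => (torsionLayers ρ e hD).finite k
  have hyk : ∀ k, cohomologyMap ((torsionLayers ρ e hD).dualSystem.projHom k) 1 y ∈
      shaOneDualLevel S (torsionLayers ρ e hD) k :=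
    projHom_mem_shaOneDualLevel S (torsionLayers ρ e hD) inv (fun w _ => hinv (Sum.inr w)) hUO hSp
      (fun w hw k => isUnramifiedAt_layerRep_torsionLayers ρ e hD k hw) y hy.1 hy.2
  obtain ⟨r, hr, h0⟩ := exists_nonZeroDivisor_dualEndHom_eq_zero_of_LEO (E := torsionLayers ρ e hD)
    (hN := torsionBySet_maximalIdeal_pow_le_comap ρ) hT hDa
    (fun r k d hd => smul_mem_torsionLayers ρ e hD k r d hd)
    (fun r k z => layerDualEndHom_mem_shaOneDualLevel S (torsionLayers ρ e hD) _ _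
      (smul_toGaloisModule_apply r) k z.2)
    hDb₂ (fun d => (torsionLayers ρ e hD).exhaustive d) hLEO y hyk
  exact ⟨r, nonZeroDivisors.ne_zero hr, h0⟩

end Literature.NumberTheory.IwasawaTheory.Greenberg2016
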